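import Mathlib
import Summits.Ventures.PercRepro2.TypedTriangleTwo

/-!
# The symmetrised form of `K₃` as three PD-gated pieces (blind cell PercRepro2, mine-2 g37,
2026-08-28; `proofs/MINE2-FIBRE.md` §0, the form of MINE2-MERGED §6 (1))

On states, `Dst x y w = 1_Q(x) 1_Q(y) 1_Q(w) · [ 1_PD(x) (F(w) − F(y)) (σ_b(w) − σ_b(y))
+ (1_PD u_o)(y) (σ₃(w) − σ₃(x)) (σ_b(w) − σ_b(x)) − 1_PD(x) 1_PD(w) (u_o(w) − u_o(x)) (u_b(w) − u_b(x)) ]`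
with `F = σ_o − σ₃ u_o`.  Its `S₃`-symmetrisation is twice the symmetrised kernel `KBsym`
(`Dsym_eq`; a polynomial identity in the twelve side indicators once the six `(L₃, H₃)` bits are
fixed — 64 cases, `ring`), so that twice the typed count of `K₃` is the typed count of `Dst` on the
states (`two_mul_typedCount_eq_pieces`, through night-3's `six_mul_typedCount`).

Own code; standard axioms.
-/

namespace Summit.Ventures.PercRepro2

open UnionCluster

namespace CovForm

namespace LocusBridge

open OneTyped Untouched

/-! ## The pieces on states -/

section States

/-- `σ_o − σ₃ 1_{o ∈ U}` on states. -/
def Fs (s : St) : ℤ := sigB s.Lo s.Ho - sigB s.L3 s.H3 * uB s.Lo s.Ho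

/-- `σ_b` on states. -/
def sbs (s : St) : ℤ := sigB s.Lb s.Hb

/-- `σ₃` on states. -/
def s3s (s : St) : ℤ := sigB s.L3 s.H3

/-- `1_{o ∈ U}` on states. -/
def uos (s : St) : ℤ := uB s.Lo s.Ho

/-- `1_{b ∈ U}` on states. -/
def ubs (s : St) : ℤ := uB s.Lb s.Hb

/-- The three pieces of the symmetrised form on a state triple: the `PD` gate in `x` comparing `y`
and `w`, the `PD·u_o` gate in `y` comparing `x` and `w`, and the two-`PD` piece on `x, w`. -/
def Dst (x y w : St) : ℤ :=
  qB x * qB y * qB w *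
    (pdB x * (Fs w - Fs y) * (sbs w - sbs y) + pdB y * uos y * (s3s w - s3s x) * (sbs w - sbs x)
      - pdB x * pdB w * (uos w - uos x) * (ubs w - ubs x))

/-- **The symmetrised form**: the `S₃`-symmetrisation of the pieces is twice the symmetrised kernel. -/
theorem Dsym_eq (x y w : St) :
    Dst x y w + Dst x w y + Dst y x w + Dst y w x + Dst w x y + Dst w y x = 2 * KBsym x y w := by
  obtain ⟨xq, xLo, xHo, xLb, xHb, xL3, xH3⟩ := x
  obtain ⟨yq, yLo, yHo, yLb, yHb, yL3, yH3⟩ := y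
  obtain ⟨wq, wLo, wHo, wLb, wHb, wL3, wH3⟩ := w
  cases xq <;> cases yq <;> cases wq <;>
    simp only [Dst, KBsym, KB, Fs, sbs, s3s, uos, ubs, qB, pdB, sigB, uB, St.q', St.Lo, St.Ho,
      St.Lb, St.Hb, St.L3, St.H3, Bool.false_eq_true, if_false, if_true, mul_zero, zero_mul,
      add_zero, zero_add, sub_zero, sub_self, mul_one, one_mul]
  cases xL3 <;> cases xH3 <;> cases yL3 <;> cases yH3 <;> cases wL3 <;> cases wH3 <;>
    simp only [Bool.or_false, Bool.or_true, Bool.false_eq_true, if_false, if_true] <;> ring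

end States

/-! ## Twice the typed count of `K₃` is the typed count of the pieces -/

section Count

open Classical

variable {V : Type*} {E : Type*} [Fintype E] [DecidableEq E] {R : Type*} [Field R]
  [LinearOrder R] [IsStrictOrderedRing R]
variable (ends : E → Sym2 V) (o a₁ a₂ a₃ b : V)

omit [LinearOrder R] [IsStrictOrderedRing R] in
/-- Doubling a kernel doubles its typed count. -/
lemma typedCount_two_mul (F : Finset E) (z : Config E) (τ : E → ℕ)
    (K : Config E → Config E → Config E → R) :
    typedCount F z τ (fun x y w => 2 * K x y w) = 2 * typedCount F z τ K := by
  have h := TypedRed.typedCount_add F z τ K K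
  have e : typedCount F z τ (fun x y w => 2 * K x y w) =
      typedCount F z τ (fun x y w => K x y w + K x y w) :=
    TypedRed.typedCount_congr_K F z τ fun x y w => by ring
  rw [e, h]; ring

/-- The pieces on the states of a configuration triple. -/
noncomputable def Dc (x y w : Config E) : R :=
  ((Dst (st ends o a₁ a₂ a₃ b x) (st ends o a₁ a₂ a₃ b y) (st ends o a₁ a₂ a₃ b w) : ℤ) : R)

/-- **Twice the typed count of `K₃` is the typed count of the three pieces.** -/
theorem two_mul_typedCount_eq_pieces (F : Finset E) (z : Config E) (τ : E → ℕ)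
    (hτ : ∀ e ∈ F, τ e = 1 ∨ τ e = 2) :
    2 * typedCount F z τ (K3 ends o a₁ a₂ a₃ b : Config E → Config E → Config E → R) =
      typedCount F z τ (Dc ends o a₁ a₂ a₃ b) := by
  have h6 := Triangle.six_mul_typedCount_KBsym'' (R := R) ends o a₁ a₂ a₃ b F z τ hτ
  have hD := six_mul_typedCount (R := R) F z τ hτ (Dc ends o a₁ a₂ a₃ b : Config E → Config E → Config E → R)
  have hsym : typedCount F z τ (fun x y w => Dc ends o a₁ a₂ a₃ b x y w +
      Dc ends o a₁ a₂ a₃ b x w y + Dc ends o a₁ a₂ a₃ b y x w + Dc ends o a₁ a₂ a₃ b y w x +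
      Dc ends o a₁ a₂ a₃ b w x y + Dc ends o a₁ a₂ a₃ b w y x) =
      typedCount F z τ (fun x y w => 2 * ((KBsym (st ends o a₁ a₂ a₃ b x) (st ends o a₁ a₂ a₃ b y)
        (st ends o a₁ a₂ a₃ b w) : ℤ) : R)) := by
    refine TypedRed.typedCount_congr_K F z τ fun x y w => ?_
    unfold Dc
    have := Dsym_eq (st ends o a₁ a₂ a₃ b x) (st ends o a₁ a₂ a₃ b y) (st ends o a₁ a₂ a₃ b w)
    exact_mod_cast this
  rw [hsym, typedCount_two_mul] at hD
  have h6' : (6 : R) ≠ 0 := by norm_num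
  apply mul_left_cancel₀ h6'
  calc (6 : R) * (2 * typedCount F z τ (K3 ends o a₁ a₂ a₃ b : Config E → Config E → Config E → R))
      = 2 * (6 * typedCount F z τ (K3 ends o a₁ a₂ a₃ b : Config E → Config E → Config E → R)) := by
        ring
    _ = 2 * typedCount F z τ (fun x y w => ((KBsym (st ends o a₁ a₂ a₃ b x) (st ends o a₁ a₂ a₃ b y)
        (st ends o a₁ a₂ a₃ b w) : ℤ) : R)) := by rw [h6]
    _ = 6 * typedCount F z τ (Dc ends o a₁ a₂ a₃ b) := hD.symm

end Count

end LocusBridge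

end CovForm

end Summit.Ventures.PercRepro2
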